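import Mathlib.MeasureTheory.Measure.MeasureSpace
import Mathlib.Algebra.Order.AbsoluteValue.Basic
import Mathlib.Analysis.SpecialFunctions.Pow.Real
import Mathlib.Analysis.SpecialFunctions.Log.ENNRealLog
import Mathlib.Algebra.BigOperators.Finprod
import Mathlib.Algebra.Module.Submodule.Map
import Mathlib.Algebra.Algebra.Pi
import Literature.IUT.LogThetaLattice.PacketLogVolumes
import Literature.IUT.LogThetaLattice.PacketWeights
import Literature.IUT.LogThetaLattice.HolomorphicHull
import HarnessLib

/-!
# Joshi, ATS III [J-III] §9.10 «Relationship with Mochizuki's log-volumes and hulls» — the OBJECTS, typed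

K. Joshi, *Construction of Arithmetic Teichmüller Spaces III* (arXiv:2401.13508 **v4**, «Preliminary version for
comments», UNREFEREED; bib `Joshi2024ATS3`; render `HOME/lit/renders/Joshi-arxiv-2401.13508/pNNNN.txt`, «p.N l.M» =
PDF page N line M), §9.10 pp.121–127: the volume / log-volume / weighted-volume / hull vocabulary consumed by Joshi's
fundamental estimate Thm. 9.11.1 (p.127; seat E-t4) and its printed relation to [IUTchIII] Prop. 3.9, Rmk. 3.1.1,
Rmk. 3.9.5. Cell abc-iut, block E (rung LADDER-ABC:A2.E), seat E-t23, slot T-23, OBJECTS.tsv O-045; registry ids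
J3:Lem9.10.2.2, J3:Lem9.10.3.2, J3:Lem9.10.7.1, J3:Prop9.10.8.1(1)(2)(3), J3:Rmk9.10.8.2.
FRAMING: typed ≠ proved; typed AS A CANDIDATE ≠ endorsed; no side taken on [IUTchIII] Cor. 3.12 or on any author. DATA
Joshi defines = `structure`/`def` AS PRINTED (signature fields carry the properties print invokes, with locators);
what FOLLOWS from the signature is PROVED (Lem. 9.10.2.2 (1)(3)(4), Lem. 9.10.3.2, finiteness of (9.10.4.1), `Γ_p ⊂
(0,1]`, (P1)–(P3) for Joshi's hull, Prop. 9.10.8.1 (1) module part, (2), Lem. 9.10.7.1); the one assertion that does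
not (Prop. 9.10.8.1 (3)) is a `Prop`-valued `def` [claim: Joshi2024ATS3, status: disputed], asserted nowhere. No
frozen adjudication file is imported (binding to `Cor312.Setting` = the lead's `Joshi/Dictionary.lean`, E-PLAN R4b);
the DICTIONARY rows are proved against the Literature layer: `log Vol^Γ = packetLogVolume` (Prop. 3.9 (i)), `Γ_p =
packetWeightRaw` and the factor `[L_mod : ℚ]` to `packetWeight` (Rmk. 3.1.1 (ii); Joshi's «coincides» located, not
graded), Joshi hull-sets (`λ_α ∈ 𝒪`, INTEGRAL) `⊆` `IsHullSet`, `holomorphicHull ⊆ joshiHull` (Rmk. 3.9.5 (i)).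
TYPING NOTE: (9.10.3.1) defines `Vol^Γ` on ball-tensors only (p.124 l.8–11; REPRESENTED here by the tuple `(V_i)`),
while Lem. 9.10.7.1 evaluates it on `hull(S) ⊂ ⊕_α E′_α` (p.125 l.45); the junction — ONE monotone volume on the
ambient space extending (9.10.3.1) — is the signature `TensorVolumeDatum`, object-level home of datum D-05/Y_vol.
§9.10.6 (p.125 l.20–26: volumes «extend verbatim» to the log-shell spaces) = pointer to OUR `Thm311.MRData.logvol`
(row D-09, T-20). NOT here: §9.9/§9.11 (E-t4), loci `Θ̃^I` (T-22), tensor packets (T-20), tests vs S. merge-debt: none.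
-/

noncomputable section

namespace Summit.ABC.IUTFork.Joshi.LogVol

open MeasureTheory Literature.IUT.LogThetaLattice

/-! ## §9.10.2 Volumes and log-volumes on one p-adic field (p.122 l.32 – p.123 l.38) -/

/-- [J-III] §9.10.2, p.122 l.32–46, p.123 l.11–22: «L′_w … p-adic field, 𝒪_{L′_w} … a unique normalized translation
invariant (real valued) Haar measure … Vol_{L′_w} … Vol_{L′_w}(𝒪_{L′_w}) = 1», with `|−|_E` normalised by «Vol(π𝒪) =
|π|» / Lem. 9.10.2.2 (2). SIGNATURE (fields = what print invokes). [claim: Joshi2024ATS3, status: disputed] -/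
structure VolumeDatum (E : Type*) [Field E] [MeasurableSpace E] where
  /-- `Vol_E`, the normalised Haar measure (p.122 l.37–40) -/ vol : Measure E
  /-- `𝒪_E` (p.122 l.33–36) -/ O : Subring E
  /-- `|−|_E` (p.123 l.24) -/ abs : AbsoluteValue E ℝ
  /-- `Vol_E(𝒪_E) = 1` (p.122 l.44–46) -/ vol_O : vol (O : Set E) = 1
  /-- translation invariance (p.122 l.38; Lem. 9.10.2.2 (1)) -/
  vol_translate : ∀ (a : E) (S : Set E), vol ((fun x => a + x) '' S) = vol S
  /-- `Vol(λ𝒪_E) = |λ|_E`, `λ ≠ 0` (p.123 l.13–15; Lem. 9.10.2.2 (2) «clear from the definition of Vol_E») -/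
  vol_mulBall : ∀ l : E, l ≠ 0 → vol ((fun x => l * x) '' (O : Set E)) = ENNReal.ofReal (abs l)
  /-- `|x|_E ≤ 1` on `𝒪_E` (used at Lem. 9.10.7.1, p.125 l.54–55) -/ abs_le_one : ∀ x ∈ O, abs x ≤ 1

namespace VolumeDatum

variable {E : Type*} [Field E] [MeasurableSpace E] (D : VolumeDatum E)

/-- `S = α + λ·𝒪_E` (Lem. 9.10.2.2, p.123 l.24–25). [claim: Joshi2024ATS3, status: disputed] -/
def ball (α l : E) : Set E := (fun x => α + l * x) '' (D.O : Set E)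

/-- `λ·𝒪_E` is the ball at `α = 0`. [folklore] -/
theorem ball_zero (l : E) : D.ball 0 l = (fun x => l * x) '' (D.O : Set E) := by simp [ball]

/-- (9.10.2.1)–p.123 l.5: «LogVol(S) = log(Vol(S)) ∈ ℝ ∪ {±∞}», «log(0) = −∞, log(∞) = ∞» — exactly Mathlib's
`ENNReal.log : ℝ≥0∞ → EReal`. [claim: Joshi2024ATS3, status: disputed] -/
def logVol (S : Set E) : EReal := ENNReal.log (D.vol S)

/-- p.123 l.6–10: «LogVol(𝒪_{L′_w}) = 0». PROVED. [claim: Joshi2024ATS3, status: disputed] -/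
theorem logVol_O : D.logVol (D.O : Set E) = 0 := by simp [logVol, D.vol_O]

/-- **Lem. 9.10.2.2 (1)** (p.123 l.26–27): «Vol_E(α + λ·𝒪_E) = Vol(λ𝒪_E)» (transl. inv.). [claim: Joshi2024ATS3, status: disputed] -/
theorem vol_ball_eq (α l : E) : D.vol (D.ball α l) = D.vol (D.ball 0 l) := by
  rw [show D.ball α l = (fun x => α + x) '' D.ball 0 l by rw [ball_zero, Set.image_image]; rfl, D.vol_translate]

/-- **Lem. 9.10.2.2 (2)** (p.123 l.29–30): «Vol_E(α + λ·𝒪_E) = Vol(λ𝒪_E) = |λ|_E». [claim: Joshi2024ATS3, status: disputed] -/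
theorem vol_ball (α : E) {l : E} (hl : l ≠ 0) : D.vol (D.ball α l) = ENNReal.ofReal (D.abs l) := by
  rw [D.vol_ball_eq, D.ball_zero, D.vol_mulBall l hl]

/-- p.123 l.13–22: «Vol(π𝒪) = |π|, and so LogVol(π𝒪) = log(|π|)» (any `λ ≠ 0`). [claim: Joshi2024ATS3, status: disputed] -/
theorem logVol_ball (α : E) {l : E} (hl : l ≠ 0) : D.logVol (D.ball α l) = (Real.log (D.abs l) : EReal) := by
  rw [logVol, D.vol_ball α hl, ENNReal.log_ofReal_of_pos (D.abs.pos hl)]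

/-- `s ∈ λ𝒪 ⇒ |s| ≤ |λ|`. [folklore] -/
theorem abs_le_of_mem_ball {l s : E} (hs : s ∈ D.ball 0 l) : D.abs s ≤ D.abs l := by
  rw [ball_zero] at hs
  obtain ⟨x, hx, rfl⟩ := hs
  rw [D.abs.map_mul]
  exact mul_le_of_le_one_right (D.abs.nonneg l) (D.abs_le_one x hx)

/-- **Lem. 9.10.2.2 (3)** (p.123 l.32–33): «Vol(λ𝒪_E) = sup{|s|_E : s ∈ λ𝒪_E} = |λ|_E» — `|λ|` is the greatest
element of `{|s| : s ∈ λ𝒪}` (at `s = λ·1`; `sSup` form: `.csSup_eq`). PROVED. [claim: Joshi2024ATS3, status: disputed] -/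
theorem isGreatest_abs_ball (l : E) : IsGreatest (D.abs '' D.ball 0 l) (D.abs l) := by
  refine ⟨⟨l, ?_, rfl⟩, ?_⟩
  · rw [ball_zero]; exact ⟨1, D.O.one_mem, mul_one l⟩
  · rintro _ ⟨s, hs, rfl⟩; exact D.abs_le_of_mem_ball hs

/-- **Lem. 9.10.2.2 (4)** (p.123 l.35–36): «for any s ∈ λ·𝒪_E … Vol_E(S) ≥ |s|_E». [claim: Joshi2024ATS3, status: disputed] -/
theorem ofReal_abs_le_vol_ball (α : E) {l s : E} (hl : l ≠ 0) (hs : s ∈ D.ball 0 l) :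
    ENNReal.ofReal (D.abs s) ≤ D.vol (D.ball α l) := by
  rw [D.vol_ball α hl]; exact ENNReal.ofReal_le_ofReal (D.abs_le_of_mem_ball hs)

end VolumeDatum

/-! ## §9.10.3 Weighted volumes (p.123 l.39 – p.124 l.44); dictionary with [IUTchIII] Prop. 3.9 (i) -/

/-- §9.10.3, p.123 l.42: «Γ = {γ_1, …, γ_n} ⊂ (0, 1] ⊂ ℝ … a set of weights» (indexed by the tensor factors).
[claim: Joshi2024ATS3, status: disputed] -/
structure Weights (ι : Type*) where
  /-- `γ_i` -/ γ : ι → ℝ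
  /-- `0 < γ_i` -/ pos : ∀ i, 0 < γ i
  /-- `γ_i ≤ 1` -/ le_one : ∀ i, γ i ≤ 1

section Weighted

variable {ι : Type*} [Fintype ι] {E : ι → Type*} [∀ i, Field (E i)] [∀ i, MeasurableSpace (E i)]
  (D : ∀ i, VolumeDatum (E i)) (Γ : Weights ι)

/-- **(9.10.3.1)** (p.124 l.8–11): «it suffices to define Vol^Γ(V_1 ⊗_{ℤ_p} … ⊗_{ℤ_p} V_n) = Vol^{γ_1}_{E_1}(V_1) ···
Vol^{γ_n}_{E_n}(V_n)» (= **Lem. 9.10.3.2 (1)**, p.124 l.16–22, by `rfl`) — the set `V_1⊗…⊗V_n` REPRESENTED by the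
tuple `(V_i)` (Joshi defines `Vol^Γ` on such sets only); real powers. [claim: Joshi2024ATS3, status: disputed] -/
def weightedVol (V : ∀ i, Set (E i)) : ℝ := ∏ i, ((D i).vol (V i)).toReal ^ Γ.γ i

/-- **Lem. 9.10.3.2 (2)** (p.124 l.23–33): `V_i = α_i + λ_i𝒪_{E_i}`, `λ_i ≠ 0`: `Vol^Γ = ∏ |λ_i|^{γ_i}`. PROVED.
[claim: Joshi2024ATS3, status: disputed] -/
theorem weightedVol_ball (α l : ∀ i, E i) (hl : ∀ i, l i ≠ 0) :
    weightedVol D Γ (fun i => (D i).ball (α i) (l i)) = ∏ i, (D i).abs (l i) ^ Γ.γ i := by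
  refine Finset.prod_congr rfl fun i _ => ?_
  rw [(D i).vol_ball (α i) (hl i), ENNReal.toReal_ofReal ((D i).abs.nonneg _)]

/-- **Lem. 9.10.3.2 (3)** (p.124 l.34–44): «if s_i ∈ λ_i𝒪_{E_i} ∩ E_i* then Vol^Γ(V_1⊗…⊗V_n) ≥ ∏ |s_i|^{γ_i}» (uses
`γ_i > 0`; `s_i ≠ 0` is not needed). PROVED. [claim: Joshi2024ATS3, status: disputed] -/
theorem prod_abs_rpow_le_weightedVol (α l s : ∀ i, E i) (hl : ∀ i, l i ≠ 0)
    (hs : ∀ i, s i ∈ (D i).ball 0 (l i)) :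
    ∏ i, (D i).abs (s i) ^ Γ.γ i ≤ weightedVol D Γ (fun i => (D i).ball (α i) (l i)) := by
  rw [weightedVol_ball D Γ α l hl]
  exact Finset.prod_le_prod (fun i _ => Real.rpow_nonneg ((D i).abs.nonneg _) _) fun i _ =>
    Real.rpow_le_rpow ((D i).abs.nonneg _) ((D i).abs_le_of_mem_ball (hs i)) (Γ.pos i).le

/-- **DICTIONARY (D-05, object level), PROVED**: `log` of Joshi's weighted volume (9.10.3.1) of `V_1⊗…⊗V_n` IS
[IUTchIII] Prop. 3.9 (i)'s direct-product-region packet log-volume `packetLogVolume γ Vol V = Σ_i γ_i·log Vol(V_i)`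
for the SAME weights and measures (when the `Vol(V_i)` are positive reals). Our reading. [folklore] -/
theorem log_weightedVol_eq_packetLogVolume (V : ∀ i, Set (E i)) (hV : ∀ i, 0 < ((D i).vol (V i)).toReal) :
    Real.log (weightedVol D Γ V) = packetLogVolume Γ.γ (fun i => (D i).vol) V := by
  unfold weightedVol packetLogVolume
  rw [Real.log_prod]
  · exact Finset.sum_congr rfl fun i _ => Real.log_rpow (hV i) _
  · exact fun i _ => (Real.rpow_pos_of_pos (hV i) _).ne'

end Weighted

/-! ## §9.10.4 Adelic weighted volumes (p.124 l.45 – p.125 l.1) -/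

section Adelic

variable {W : Type*} {E : W → Type*} [∀ w, Field (E w)] [∀ w, MeasurableSpace (E w)]
  (D : ∀ w, VolumeDatum (E w)) (γ : W → ℝ)

/-- **(9.10.4.1)** (p.124 l.60–73): «Vol(∏_{w∈𝕍}(λ_w·𝒪_{L′_w})) = ∏_{w∈𝕍} Vol_{L′_w}(λ_w·𝒪_{L′_w}) with some choice of
weights», `λ_w ∈ 𝒪*` off finitely many `w` (p.124 l.51–56) — a finitary product `∏ᶠ`. [claim: Joshi2024ATS3, status: disputed] -/
def adelicVol (lam : ∀ w, E w) : ℝ := ∏ᶠ w, ((D w).vol ((D w).ball 0 (lam w))).toReal ^ γ w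

/-- p.124 l.73–77: «The condition that λ_w ∈ 𝒪* for all but finitely many w ensures that this volume is finite»: if
`|λ_w| = 1` off a finite `F`, the adelic volume is `∏_{w∈F} |λ_w|^{γ_w}`. PROVED. [claim: Joshi2024ATS3, status: disputed] -/
theorem adelicVol_eq_prod (lam : ∀ w, E w) (hl : ∀ w, lam w ≠ 0) (F : Finset W)
    (hF : ∀ w, w ∉ F → (D w).abs (lam w) = 1) :
    adelicVol D γ lam = ∏ w ∈ F, (D w).abs (lam w) ^ γ w := by
  have h : ∀ w, ((D w).vol ((D w).ball 0 (lam w))).toReal ^ γ w = (D w).abs (lam w) ^ γ w := fun w => by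
    rw [(D w).vol_ball 0 (hl w), ENNReal.toReal_ofReal ((D w).abs.nonneg _)]
  unfold adelicVol
  simp_rw [h]
  refine finprod_eq_prod_of_mulSupport_subset _ fun w hw => ?_
  by_contra hwF
  simp only [Function.mem_mulSupport, ne_eq] at hw
  exact hw (by rw [hF w (fun h' => hwF (Finset.mem_coe.2 h')), Real.one_rpow])

end Adelic

/-! ## §9.10.5 The weights `Γ_p` (9.10.5.1) and [IUTchIII] Rmk. 3.1.1 (p.125 l.2–19) -/

section GammaP

variable {W : Type*}

/-- **(9.10.5.1)** (p.125 l.9–12): «Γ_p = {1/[L′_{w_i} : L_{mod,v}] : w_i ∈ 𝕍^{odd,ss}_p}», `deg w = [L′_w : L_{mod,v}]`.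
[claim: Joshi2024ATS3, status: disputed] -/
def gammaP (deg : W → ℕ+) (w : W) : ℝ := 1 / (deg w : ℝ)

/-- `0 < γ` (weights in `(0, 1]` as §9.10.3 requires). PROVED. [folklore] -/
theorem gammaP_pos (deg : W → ℕ+) (w : W) : 0 < gammaP deg w :=
  one_div_pos.2 (by exact_mod_cast (deg w).pos)

/-- `γ ≤ 1` (so `⟨gammaP deg, gammaP_pos deg, gammaP_le_one deg⟩ : Weights W` is `Γ_p`). PROVED. [folklore] -/
theorem gammaP_le_one (deg : W → ℕ+) (w : W) : gammaP deg w ≤ 1 :=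
  (div_le_one (by exact_mod_cast (deg w).pos)).2 (Nat.one_le_cast.2 (deg w).pos)

/-- **DICTIONARY, PROVED**: p.125 l.13–15 «This set of weights … coincides with the choice of weights in [Mochizuki,
2021c, Remark 3.1.1]» — `1/[L′_w : L_{mod,v}]` IS Rmk. 3.1.1 (ii)'s UNnormalised weight `1/[K_v : (F_mod)_v]` =
`packetWeightRaw` on a single place (`A = Fin 1`; `K = L′`, `F_mod = L_mod`). [claim: Joshi2024ATS3, status: disputed] -/
theorem gammaP_eq_packetWeightRaw (deg : W → ℕ+) (w : W) :
    gammaP deg w = packetWeightRaw deg (fun _ : Fin 1 => w) := by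
  unfold gammaP packetWeightRaw
  rw [Fin.prod_univ_one]

/-- **DICTIONARY, PROVED**: against the NORMALISED weight of Rmk. 3.1.1 (ii) (`packetWeight`: «multiplication by
p_{v_ℚ} affects log-volumes by ± log(p_{v_ℚ})») Joshi's `γ` differs by the factor `Σ_{w′|p}[(L_mod)_{w′} : ℚ_p] =
[L_mod : ℚ]`, a GLOBAL constant (the same on both sides of Cor. 9.11.1.1). Located, not graded. [folklore] -/
theorem packetWeight_eq_gammaP_div [Fintype W] (degF deg : W → ℕ+) (w : W) :
    packetWeight degF deg w = gammaP deg w / ∑ w', (degF w' : ℝ) := by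
  unfold packetWeight gammaP
  rw [div_div]

end GammaP

/-! ## §9.10.7 Hulls à la Joshi (p.125 l.27–55) in the direct-sum model `⊕_α E′_α = Π_α k_α` -/

section Hull

variable {A : Type*} {k : A → Type*} [∀ a, Field (k a)] (O : ∀ a, Subring (k a))

/-- §9.10.7, p.125 l.33–38: the sets «of the form ⊕_α λ_α𝒪_{E′_α} where 0 ≠ λ_α ∈ 𝒪_{E′_α}» in `E_1⊗_{ℚ_p}…⊗E_n = ⊕_α
E′_α` — Joshi's hull-sets; NOTE the integrality `λ_α ∈ 𝒪` (Mochizuki's `λ·𝒪`, Rmk. 3.9.5 (i) = `IsHullSet`, allows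
any `λ` with nonzero components). [claim: Joshi2024ATS3, status: disputed] -/
def IsJoshiHullSet (H : Set (∀ a, k a)) : Prop :=
  ∃ lam : ∀ a, k a, (∀ a, lam a ≠ 0 ∧ lam a ∈ O a) ∧
    H = Set.univ.pi fun a => (fun x => lam a * x) '' (O a : Set (k a))

/-- **DICTIONARY, PROVED**: a Joshi hull-set is a hull-set `λ·𝒪_{(−)}` of [IUTchIII] Rmk. 3.9.5 (i) (`IsHullSet`).
[folklore] -/
theorem IsJoshiHullSet.isHullSet {H : Set (∀ a, k a)} (h : IsJoshiHullSet O H) : IsHullSet O H := by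
  obtain ⟨lam, hlam, hH⟩ := h
  exact ⟨lam, fun a => (hlam a).1, hH⟩

/-- §9.10.7, p.125 l.33–34: «hull(S) is the smallest subset … ⊃ S … whose image in the direct sum decomposition … is
of the form ⊕_α λ_α𝒪_{E′_α}» — the intersection of the Joshi hull-sets `⊇ S` (that it is itself one, for bounded
non-degenerate `S`, is print's implicit existence claim, cf. `holomorphicHull_isHullSet`). [claim: Joshi2024ATS3, status: disputed] -/
def joshiHull (S : Set (∀ a, k a)) : Set (∀ a, k a) := ⋂₀ {H | IsJoshiHullSet O H ∧ S ⊆ H}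

/-- «hull(S) ⊃ S» (P2). PROVED. [claim: Joshi2024ATS3, status: disputed] -/
theorem subset_joshiHull (S : Set (∀ a, k a)) : S ⊆ joshiHull O S := Set.subset_sInter fun _ hH => hH.2

/-- «smallest»: a Joshi hull-set containing `S` contains `hull(S)`. PROVED. [claim: Joshi2024ATS3, status: disputed] -/
theorem joshiHull_subset_of_mem {S H : Set (∀ a, k a)} (hH : IsJoshiHullSet O H) (hSH : S ⊆ H) :
    joshiHull O S ⊆ H := Set.sInter_subset_of_mem ⟨hH, hSH⟩

/-- (P3) monotonicity, which p.125 l.39–40 takes from [IUTchIII] Rmk. 3.9.5 (ii). PROVED.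
[claim: Joshi2024ATS3, status: disputed] -/
theorem joshiHull_mono {S S' : Set (∀ a, k a)} (h : S ⊆ S') : joshiHull O S ⊆ joshiHull O S' :=
  Set.sInter_subset_sInter fun _ hH => ⟨hH.1, h.trans hH.2⟩

/-- (P1): the hull of a Joshi hull-set is itself. PROVED. [claim: Joshi2024ATS3, status: disputed] -/
theorem joshiHull_eq_self {H : Set (∀ a, k a)} (hH : IsJoshiHullSet O H) : joshiHull O H = H :=
  (joshiHull_subset_of_mem O hH le_rfl).antisymm (subset_joshiHull O H)

/-- **DICTIONARY, PROVED**: for relatively compact `U`, Mochizuki's holomorphic hull (`holomorphicHull`, the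
intersection over ALL hull-sets `⊇ U`) is contained in Joshi's hull (over the integral ones only). [folklore] -/
theorem holomorphicHull_subset_joshiHull [∀ a, TopologicalSpace (k a)] {U : Set (∀ a, k a)}
    (hU : IsCompact (closure U)) : holomorphicHull O U ⊆ joshiHull O U := by
  unfold holomorphicHull joshiHull
  rw [if_pos hU]
  exact Set.sInter_subset_sInter fun H hH => ⟨hH.1.isHullSet O, hH.2⟩

/-- A Joshi hull-set contains `0` (towards Prop. 9.10.8.1 (1) «the hull is a ℤ_p-module»). PROVED. [folklore] -/
theorem IsJoshiHullSet.zero_mem {H : Set (∀ a, k a)} (h : IsJoshiHullSet O H) : (0 : ∀ a, k a) ∈ H := by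
  obtain ⟨lam, -, rfl⟩ := h
  exact fun a _ => ⟨0, (O a).zero_mem, by simp⟩

/-- A Joshi hull-set is closed under addition. PROVED. [folklore] -/
theorem IsJoshiHullSet.add_mem {H : Set (∀ a, k a)} (h : IsJoshiHullSet O H) {x y : ∀ a, k a} (hx : x ∈ H)
    (hy : y ∈ H) : x + y ∈ H := by
  obtain ⟨lam, -, rfl⟩ := h
  simp only [Set.mem_univ_pi, Set.mem_image, SetLike.mem_coe] at hx hy ⊢
  intro a
  obtain ⟨u, hu, hux⟩ := hx a
  obtain ⟨v, hv, hvy⟩ := hy a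
  exact ⟨u + v, (O a).add_mem hu hv, by rw [Pi.add_apply, ← hux, ← hvy, mul_add]⟩

/-- A Joshi hull-set is stable under the diagonal action of `Π_α 𝒪_{E′_α}` ([IUTchIII] Rmk. 3.9.5 (vii) (Ob2) =
`IsHullSet.mul_mem`). PROVED. [folklore] -/
theorem IsJoshiHullSet.mul_mem {H : Set (∀ a, k a)} (h : IsJoshiHullSet O H) {c x : ∀ a, k a}
    (hc : ∀ a, c a ∈ O a) (hx : x ∈ H) : c * x ∈ H := (h.isHullSet O).mul_mem O hc hx

end Hull

/-! ## §9.10.8 Hulls and convex closures (p.126 l.1 – p.127 l.2) -/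

section Convex

variable (R : Type*) [CommRing R] {X : Type*} [AddCommGroup X] [Module R X]

/-- Non-archimedean CONVEXITY (p.126 l.3–4 «convex closure can be made in any Banach space [Schneider, 2002]»;
Schneider, NFA Ch. I §2: `∅` or `v + M`, `M` an `𝒪_K`-submodule), for scalars `R` (print: `R = ℤ_p`). [folklore] -/
def IsConvexNA (C : Set X) : Prop := C = ∅ ∨ ∃ (v : X) (M : Submodule R X), C = (fun m => v + m) '' (M : Set X)

/-- The convex closure: the smallest convex subset containing `U` (p.126 l.30–31). [folklore] -/
def convexClosure (U : Set X) : Set X := ⋂₀ {C | IsConvexNA R C ∧ U ⊆ C}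

/-- **Prop. 9.10.8.1 (2)** (p.126 l.27–28): «If V ⊂ E_1⊗_{ℚ_p}E_2 is a convex subset … its image under f is also
convex» — PROVED for any `R`-linear `f` (print's `f : E_1⊗E_2 ≃ ⊕_α F_α`). [claim: Joshi2024ATS3, status: disputed] -/
theorem IsConvexNA.image {Y : Type*} [AddCommGroup Y] [Module R Y] (f : X →ₗ[R] Y) {C : Set X}
    (h : IsConvexNA R C) : IsConvexNA R (f '' C) := by
  rcases h with rfl | ⟨v, M, rfl⟩
  · exact Or.inl (Set.image_empty f)
  · refine Or.inr ⟨f v, M.map f, ?_⟩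
    rw [Submodule.map_coe, Set.image_image, Set.image_image]
    exact Set.image_congr fun m _ => by simp

variable {A : Type*} {k : A → Type*} [∀ a, Field (k a)] [∀ a, Algebra R (k a)] (O : ∀ a, Subring (k a))

/-- **Prop. 9.10.8.1 (1), module part** (p.126 l.25–26, l.32–34 «the hull is an ℤ_p-module … a convex subset as it is
an ℤ_p-module»): a Joshi hull-set is the carrier of an `R`-submodule whenever `R` maps into every `𝒪_{F_α}` (as
`ℤ_p` does), hence convex (`v = 0`). PROVED. Minimality clause = (P1)–(P3) of [IUTchIII] Rmk. 3.9.5 (ii) =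
`hullMap_eq_sInter` (cited, not re-proved). [claim: Joshi2024ATS3, status: disputed] -/
theorem IsJoshiHullSet.isConvexNA (hR : ∀ a (r : R), algebraMap R (k a) r ∈ O a) {H : Set (∀ a, k a)}
    (h : IsJoshiHullSet O H) : IsConvexNA R H := by
  let M : Submodule R (∀ a, k a) :=
    { carrier := H
      zero_mem' := h.zero_mem O
      add_mem' := fun hx hy => h.add_mem O hx hy
      smul_mem' := fun r x hx => by
        have : r • x = (fun a => algebraMap R (k a) r) * x := by
          funext a; simp [Algebra.smul_def]
        rw [this]
        exact h.mul_mem O (fun a => hR a r) hx }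
  exact Or.inr ⟨0, M, by simp [M]⟩

/-- **Prop. 9.10.8.1 (3)** (p.126 l.29–31): «if P is a tensor product region of P ⊆ E_1⊗_{ℚ_p}E_2 in the sense of
[Mochizuki, 2021c, Remark 3.1.1], then H(P) ⊆ ⊕_α F_α is the image of the convex closure of P»; Rmk. 9.10.8.2 (p.127
l.1–2): «one can work with hulls and convex closures on an equal footing …». HYPOTHESIS (asserted in print, not
derived), over coordinates `f` and an abstract family of «tensor product regions». [claim: Joshi2024ATS3, status: disputed] -/
@[claim "Joshi2024ATS3" "disputed"]
def HullEqImageConvexClosure (f : X →ₗ[R] (∀ a, k a)) (TensorRegion : Set (Set X)) : Prop :=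
  ∀ P ∈ TensorRegion, joshiHull O (f '' P) = f '' convexClosure R P

end Convex

/-! ## Lem. 9.10.7.1 (p.125 l.42–55): the chain of inequalities, over ONE volume on the ambient space -/

/-- The junction of (9.10.3.1) (ball-tensors, p.124 l.8–11) with §9.10.6–§9.10.7 (hulls in `⊕_α E′_α`, p.125 l.24–26,
l.45): ONE volume `Vol` on `X = E_1⊗_{ℚ_p}…⊗E_n` («for any measurable set S … one can talk of its volume Vol(S)»)
extending (9.10.3.1) on ball-tensors, and a hull operator with (P2), (P3). SIGNATURE; object-level home of
dictionary row D-05. [claim: Joshi2024ATS3, status: disputed] -/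
structure TensorVolumeDatum (ι : Type*) [Fintype ι] (E : ι → Type*) [∀ i, Field (E i)]
    [∀ i, MeasurableSpace (E i)] (X : Type*) [MeasurableSpace X] where
  /-- the factors `(E_i, Vol_{E_i}, 𝒪_{E_i}, |−|_{E_i})` -/ D : ∀ i, VolumeDatum (E i)
  /-- the weights `Γ_p` -/ Γ : Weights ι
  /-- `Vol` on `X` (§9.10.6) -/ vol : Measure X
  /-- `(V_i) ↦ V_1 ⊗_{ℤ_p} … ⊗_{ℤ_p} V_n ⊂ X` -/ tens : (∀ i, Set (E i)) → Set X
  /-- (9.10.3.1) as a property of `Vol`: on ball-tensors `Vol` is the Γ-weighted volume -/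
  vol_tens : ∀ α l : ∀ i, E i, (∀ i, l i ≠ 0) →
    vol (tens fun i => (D i).ball (α i) (l i)) = ENNReal.ofReal (weightedVol D Γ fun i => (D i).ball (α i) (l i))
  /-- `hull` (§9.10.7, through the coordinates `X ≃ ⊕_α E′_α`) -/ hull : Set X → Set X
  /-- (P2) `S ⊆ hull(S)` -/ subset_hull : ∀ S, S ⊆ hull S
  /-- (P3) monotonicity -/ hull_mono : ∀ S S', S ⊆ S' → hull S ⊆ hull S'

namespace TensorVolumeDatum

variable {ι : Type*} [Fintype ι] {E : ι → Type*} [∀ i, Field (E i)] [∀ i, MeasurableSpace (E i)] {X : Type*}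
  [MeasurableSpace X] (T : TensorVolumeDatum ι E X)

/-- **Lem. 9.10.7.1, last two inequalities** (p.125 l.45–55): `s_i ∈ τ_i𝒪_{E_i}`, `τ_i ∈ 𝒪_{E_i}`:
`∏ |τ_i|^{γ_i} ≥ ∏ |s_i|^{γ_i} ≥ ∏ |s_i|` («0 < γ_i ≤ 1 … all the s_i have absolute values at most one»). PROVED.
[claim: Joshi2024ATS3, status: disputed] -/
theorem prod_abs_le_prod_abs_rpow (τ s : ∀ i, E i) (hτ : ∀ i, τ i ∈ (T.D i).O)
    (hs : ∀ i, s i ∈ (T.D i).ball 0 (τ i)) :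
    ∏ i, (T.D i).abs (s i) ≤ ∏ i, (T.D i).abs (s i) ^ T.Γ.γ i :=
  Finset.prod_le_prod (fun i _ => (T.D i).abs.nonneg _) fun i _ => by
    conv_lhs => rw [← Real.rpow_one ((T.D i).abs (s i))]
    exact Real.rpow_le_rpow_of_exponent_ge' ((T.D i).abs.nonneg _)
      (((T.D i).abs_le_of_mem_ball (hs i)).trans ((T.D i).abs_le_one _ (hτ i))) (T.Γ.pos i).le (T.Γ.le_one i)

/-- **Lem. 9.10.7.1** (p.125 l.42–52): `S′ ⊃ S = (τ_1𝒪_{E_1})⊗_{ℤ_p}…⊗(τ_n𝒪_{E_n})`, `0 ≠ τ_i ∈ 𝒪_{E_i}`, `s_i ∈ τ_i𝒪`: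
`Vol(hull S′) ≥ Vol(hull S) ≥ Vol(S) ≥ ∏|s_i|^{γ_i} ≥ ∏|s_i|`, end-to-end in `ℝ≥0∞`. PROVED from monotonicity of `Vol`,
(P2)/(P3), `vol_tens`, Lem. 9.10.3.2 («immediate from the properties of the hull in [Mochizuki, 2021c, §3]»; print's
`Vol^Γ(hull S′) ≥ Vol^{Γ_p}(hull S)` read with one weight family). [claim: Joshi2024ATS3, status: disputed] -/
theorem lemma_9_10_7_1 (τ s : ∀ i, E i) (hτ : ∀ i, τ i ∈ (T.D i).O) (hτ0 : ∀ i, τ i ≠ 0)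
    (hs : ∀ i, s i ∈ (T.D i).ball 0 (τ i)) {S' : Set X} (hS' : T.tens (fun i => (T.D i).ball 0 (τ i)) ⊆ S') :
    ENNReal.ofReal (∏ i, (T.D i).abs (s i)) ≤ T.vol (T.hull S') :=
  calc ENNReal.ofReal (∏ i, (T.D i).abs (s i))
      ≤ ENNReal.ofReal (∏ i, (T.D i).abs (s i) ^ T.Γ.γ i) :=
        ENNReal.ofReal_le_ofReal (T.prod_abs_le_prod_abs_rpow τ s hτ hs)
    _ ≤ ENNReal.ofReal (weightedVol T.D T.Γ fun i => (T.D i).ball 0 (τ i)) :=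
        ENNReal.ofReal_le_ofReal (prod_abs_rpow_le_weightedVol T.D T.Γ 0 τ s hτ0 hs)
    _ = T.vol (T.tens fun i => (T.D i).ball 0 (τ i)) := (T.vol_tens 0 τ hτ0).symm
    _ ≤ T.vol (T.hull (T.tens fun i => (T.D i).ball 0 (τ i))) := measure_mono (T.subset_hull _)
    _ ≤ T.vol (T.hull S') := measure_mono (T.hull_mono _ S' hS')

end TensorVolumeDatum

end Summit.ABC.IUTFork.Joshi.LogVol

end
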